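import Mathlib.Algebra.BigOperators.Ring.Finset
import Mathlib.Data.Real.Basic
import Mathlib.Tactic.Ring
import Mathlib.Tactic.Linarith
import HarnessLib

/-!
# The mixture (law-of-total-cumulance) identity for Sahi's cubic `E₃`

Support file for the Sahi programme (`--supports stmt-CriticalPhenomena-4575`, prover prim-sahi-p2 gen 18).  No definitions, no named
facts, no sorries; standard axioms; pure finite-sum algebra (no measure theory), so that every future 'revelation' / pinning
decomposition of the increasing star can quote it instead of re-deriving it (as `…IncStarRootStarTwoStep` and `…IncStarDualRevelation`
had to).  Memo `run/shared/lean/prim/prim-sahi/prim-sahi-p2/PROOF-E3.md` §28c.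

Setting.  A finite index set `S` of 'scenarios' `i` with weights `π i` (a mixture; `Σ π = 1` is NOT needed for the identity), and for
each scenario the seven moments of three events under the scenario's law: `xa i, xb i, xc i` (singles), `xab i, xac i, xbc i` (pairs),
`xabc i` (triple).  The MIXTURE has moments `Σ_i π_i x_T(i)`, and Sahi's cubic
`E₃ = 2·m_abc + m_a m_b m_c − m_a m_bc − m_b m_ac − m_c m_ab` is not affine in the law.  The identity
(`sahiE3_mixture_sub_sum`):

  `E₃(mixture) − Σ_i π_i E₃(scenario i) = E₃^π(xa, xb, xc) + Σ_cyc [ Σ_i π_i xa_i κ^i_bc − (Σ_i π_i xa_i)(Σ_i π_i κ^i_bc) ]`,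

where `E₃^π(xa,xb,xc) = 2Σπ xa xb xc + (Σπ xa)(Σπ xb)(Σπ xc) − Σ_cyc (Σπ xa)(Σπ xb xc)` is Sahi's cubic of the three conditional
probabilities viewed as FUNCTIONS on the scenario space, and `κ^i_bc = xbc i − xb i · xc i` is the conditional covariance in scenario `i`.
For a probability mixture (`Σπ = 1`) the bracket is `Cov_π(xa, κ_bc)`.  Instances (prim-sahi-p2 gens 16–18): scenarios = pinned ROOT stars
(`(MQ)` slack `Φ = T2 + T3`, §26h — refuted as an inequality, the identity stands), scenarios = configurations of all NON-root pairs (dual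
revelation `D′ = middle′ + junk′`, §27h), scenarios = the two states of ONE pair (the chord step of the revelation/Doob calculus, §28c).

* `sum_mul_sahiE3_expand`, `sum_mul_mul_sub` , `sum_mul_sub'` — splitting the scenario sums into atoms;
* **`sahiE3_mixture_sub_sum`** — the identity.
-/

namespace Summit.CriticalPhenomena.PercolationContinuityZ3.Theorems

namespace SahiMixture

open Finset

variable {ι : Type*}

/-- Splitting the weighted sum of the scenario cubics into its five atoms. [folklore] -/
theorem sum_mul_sahiE3_expand (S : Finset ι) (π xa xb xc xab xac xbc xabc : ι → ℝ) :
    ∑ i ∈ S, π i * (2 * xabc i + xa i * xb i * xc i - xa i * xbc i - xb i * xac i - xc i * xab i) =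
      2 * (∑ i ∈ S, π i * xabc i) + (∑ i ∈ S, π i * (xa i * xb i * xc i))
        - (∑ i ∈ S, π i * (xa i * xbc i)) - (∑ i ∈ S, π i * (xb i * xac i)) - (∑ i ∈ S, π i * (xc i * xab i)) := by
  simp only [Finset.mul_sum, ← Finset.sum_add_distrib, ← Finset.sum_sub_distrib]
  exact Finset.sum_congr rfl fun i _ => by ring

/-- Splitting `Σ π·x·(y − z·w)`. [folklore] -/
theorem sum_mul_mul_sub (S : Finset ι) (π x y z w : ι → ℝ) :
    ∑ i ∈ S, π i * (x i * (y i - z i * w i)) = (∑ i ∈ S, π i * (x i * y i)) - ∑ i ∈ S, π i * (x i * z i * w i) := by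
  rw [← Finset.sum_sub_distrib]
  exact Finset.sum_congr rfl fun i _ => by ring

/-- Splitting `Σ π·(y − z·w)`. [folklore] -/
theorem sum_mul_sub' (S : Finset ι) (π y z w : ι → ℝ) :
    ∑ i ∈ S, π i * (y i - z i * w i) = (∑ i ∈ S, π i * y i) - ∑ i ∈ S, π i * (z i * w i) := by
  rw [← Finset.sum_sub_distrib]
  exact Finset.sum_congr rfl fun i _ => by ring

/-- **The mixture identity for Sahi's cubic** (law of total cumulance at order three, in moment form):
`E₃(mixture) − Σ_i π_i·E₃(scenario i) = E₃^π(xa,xb,xc) + Σ_cyc [Σ_i π_i·xa_i·κ^i_bc − (Σ_i π_i xa_i)·(Σ_i π_i κ^i_bc)]` with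
`κ^i_bc = xbc_i − xb_i·xc_i`.  No normalisation of `π` is assumed. [this work] -/
theorem sahiE3_mixture_sub_sum (S : Finset ι) (π xa xb xc xab xac xbc xabc : ι → ℝ) :
    (2 * (∑ i ∈ S, π i * xabc i)
        + (∑ i ∈ S, π i * xa i) * (∑ i ∈ S, π i * xb i) * (∑ i ∈ S, π i * xc i)
        - (∑ i ∈ S, π i * xa i) * (∑ i ∈ S, π i * xbc i)
        - (∑ i ∈ S, π i * xb i) * (∑ i ∈ S, π i * xac i)
        - (∑ i ∈ S, π i * xc i) * (∑ i ∈ S, π i * xab i))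
      - ∑ i ∈ S, π i * (2 * xabc i + xa i * xb i * xc i - xa i * xbc i - xb i * xac i - xc i * xab i)
    = (2 * (∑ i ∈ S, π i * (xa i * xb i * xc i))
          + (∑ i ∈ S, π i * xa i) * (∑ i ∈ S, π i * xb i) * (∑ i ∈ S, π i * xc i)
          - (∑ i ∈ S, π i * xa i) * (∑ i ∈ S, π i * (xb i * xc i))
          - (∑ i ∈ S, π i * xb i) * (∑ i ∈ S, π i * (xa i * xc i))
          - (∑ i ∈ S, π i * xc i) * (∑ i ∈ S, π i * (xa i * xb i)))
      + (((∑ i ∈ S, π i * (xa i * (xbc i - xb i * xc i)))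
            - (∑ i ∈ S, π i * xa i) * (∑ i ∈ S, π i * (xbc i - xb i * xc i)))
        + ((∑ i ∈ S, π i * (xb i * (xac i - xa i * xc i)))
            - (∑ i ∈ S, π i * xb i) * (∑ i ∈ S, π i * (xac i - xa i * xc i)))
        + ((∑ i ∈ S, π i * (xc i * (xab i - xa i * xb i)))
            - (∑ i ∈ S, π i * xc i) * (∑ i ∈ S, π i * (xab i - xa i * xb i)))) := by
  rw [sum_mul_sahiE3_expand, sum_mul_mul_sub, sum_mul_mul_sub, sum_mul_mul_sub, sum_mul_sub', sum_mul_sub', sum_mul_sub']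
  have h1 : ∑ i ∈ S, π i * (xb i * xa i * xc i) = ∑ i ∈ S, π i * (xa i * xb i * xc i) :=
    Finset.sum_congr rfl fun i _ => by ring
  have h2 : ∑ i ∈ S, π i * (xc i * xa i * xb i) = ∑ i ∈ S, π i * (xa i * xb i * xc i) :=
    Finset.sum_congr rfl fun i _ => by ring
  rw [h1, h2]
  ring

/-- The identity read as a LOWER BOUND: if Sahi's cubic of the conditional probabilities (as functions on the scenario space) and the
three covariance-type brackets are nonnegative, then the mixture's cubic is at least the mixed cubics.  (Schema only; for the root-star
scenarios the brackets can be negative — `(MQ)` is false —, for the non-root scenarios this is the open `(D′)`.) [this work] -/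
theorem sum_sahiE3_le_mixture_of_nonneg (S : Finset ι) (π xa xb xc xab xac xbc xabc : ι → ℝ)
    (hF : 0 ≤ 2 * (∑ i ∈ S, π i * (xa i * xb i * xc i))
          + (∑ i ∈ S, π i * xa i) * (∑ i ∈ S, π i * xb i) * (∑ i ∈ S, π i * xc i)
          - (∑ i ∈ S, π i * xa i) * (∑ i ∈ S, π i * (xb i * xc i))
          - (∑ i ∈ S, π i * xb i) * (∑ i ∈ S, π i * (xa i * xc i))
          - (∑ i ∈ S, π i * xc i) * (∑ i ∈ S, π i * (xa i * xb i)))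
    (hJ : 0 ≤ ((∑ i ∈ S, π i * (xa i * (xbc i - xb i * xc i)))
            - (∑ i ∈ S, π i * xa i) * (∑ i ∈ S, π i * (xbc i - xb i * xc i)))
        + ((∑ i ∈ S, π i * (xb i * (xac i - xa i * xc i)))
            - (∑ i ∈ S, π i * xb i) * (∑ i ∈ S, π i * (xac i - xa i * xc i)))
        + ((∑ i ∈ S, π i * (xc i * (xab i - xa i * xb i)))
            - (∑ i ∈ S, π i * xc i) * (∑ i ∈ S, π i * (xab i - xa i * xb i)))) :
    ∑ i ∈ S, π i * (2 * xabc i + xa i * xb i * xc i - xa i * xbc i - xb i * xac i - xc i * xab i) ≤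
      2 * (∑ i ∈ S, π i * xabc i)
        + (∑ i ∈ S, π i * xa i) * (∑ i ∈ S, π i * xb i) * (∑ i ∈ S, π i * xc i)
        - (∑ i ∈ S, π i * xa i) * (∑ i ∈ S, π i * xbc i)
        - (∑ i ∈ S, π i * xb i) * (∑ i ∈ S, π i * xac i)
        - (∑ i ∈ S, π i * xc i) * (∑ i ∈ S, π i * xab i) := by
  have h := sahiE3_mixture_sub_sum S π xa xb xc xab xac xbc xabc
  linarith [h, hF, hJ]

end SahiMixture

end Summit.CriticalPhenomena.PercolationContinuityZ3.Theorems
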